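import Mathlib
import Summits.Ventures.PercRepro2.Defs
import Summits.Ventures.PercRepro2.Independence
import Summits.Ventures.PercRepro2.Harris
import Summits.Ventures.PercRepro2.Graph
import Summits.Ventures.PercRepro2.Exploration
import Summits.Ventures.PercRepro2.Events
import Summits.Ventures.PercRepro2.FourFunctions
import Summits.Ventures.PercRepro2.Induced
import Summits.Ventures.PercRepro2.Frontier
import Summits.Ventures.PercRepro2.ObsIndependence
import Summits.Ventures.PercRepro2.BHK
import Summits.Ventures.PercRepro2.BHKEvents
import Summits.Ventures.PercRepro2.MultiSource
import Summits.Ventures.PercRepro2.OrderPreservation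
import Summits.Ventures.PercRepro2.SeedSet
import Summits.Ventures.PercRepro2.MultiSourceFun
import Summits.Ventures.PercRepro2.CrossRootT
import Summits.Ventures.PercRepro2.VdBKahn
import Summits.Ventures.PercRepro2.HullDefs
import Summits.Ventures.PercRepro2.R1Rung
import Summits.Ventures.PercRepro2.CC2Rung

/-!
# (CC-T) at the edges incident to the root (blind cell PercRepro2, typer-1; mine-c g2
`MINE-C.md` §9.10 (i), INBOX 2026-08-23T09:47:48Z; lead g11 ASSIGNMENTS v11.9/v11.10 `ccT_root_edge`)

For a root `s`, an avoided set `T` (`R = {s ↮ T}`), target sets `A, B` (events `X = {A ⊆ C(s)}`,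
`Y = {B ⊆ C(s)}`) and an edge `e = {s, w}` AT THE ROOT, mine-c's (CC-T) — `CC2 p ends e s A B T T`,
the quantitative fibre-BHK along the edge line of `e` — is a theorem:

* **`shift_root_edge`** (the shift lemma `Δ_X ≥ 0`, cleared): for every up-set `𝓤`,
  `P₀(R ∩ {C(s) ∈ 𝓤}) · P₁(R) ≤ P₁(R ∩ {C(s) ∈ 𝓤}) · P₀(R)` — opening `e` glues `C(w)` to `C(s)`
  (`cluster_update_true_eq`), so on the non-pivotal part `{w ∉ C(T)}` the event only grows, while the
  pivotal part `{w ∈ C(T)}` is negatively correlated with `{C(s) ∈ 𝓤}` under `R`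
  (`bhk_cross_clusterT`, BHK 1.3 with the seed set `T`);
* `vdBK` on the contracted instance (`e` open) gives `Cov_{μ₁}(X, Y) ≥ 0` (cleared);
* **`ccT_of_shift_product`** (the algebra): `vdBK` on the contracted instance plus two shifts of
  the same sign give (CC-T) (`P₁ · slack = P₀² · (H₁P₁ − F₁G₁) + (F₁P₀ − F₀P₁)(G₁P₀ − G₀P₁)`;
  `P₁ = 0` is the degenerate case where both sides vanish);
* **`ccT_root_edge`**: `CC2 p ends e s A B T T` for every admissible `p` and every edge `e` at `s`;
* the twin at the edges incident to `T` (`shift_avoided_edge`, `ccT_avoided_edge`) is in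
  `CCTAvoidedEdge.lean`.

Numerics (mine-c): the shift `Δ_X ≥ 0` at `s`-edges 0 / 37,440 (`n = 5` exhaustive, three palettes).
-/

namespace Summit.Ventures.PercRepro2

namespace CCT

variable {V : Type*} {E : Type*} [Fintype E] [DecidableEq E] {R : Type*} [Field R]
  [LinearOrder R] [IsStrictOrderedRing R]

/-! ## Opening an edge at the root -/

section Open

variable {ends : E → Sym2 V} {e : E} {s w : V}

omit [Fintype E] in
/-- The closed-at-`e` configuration is below the open-at-`e` one. -/
lemma update_false_le_update_true' (ω : Config E) (e : E) :
    Function.update ω e false ≤ Function.update ω e true := by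
  intro e'
  by_cases h : e' = e
  · subst h; simp
  · simp [Function.update_of_ne h]

omit [Fintype E] in
/-- **Opening `e = {s, w}` glues the cluster of `w` to the cluster of `s`.** -/
lemma cluster_update_true_eq (hends : ends e = s(s, w)) (ω : Config E) :
    cluster ends (Function.update ω e true) s =
      cluster ends (Function.update ω e false) s ∪ cluster ends (Function.update ω e false) w := by
  have hle := update_false_le_update_true' ω e
  have hsw : Conn ends (Function.update ω e true) s w :=
    conn_of_openAdj ⟨e, by simp, hends⟩
  apply Set.Subset.antisymm
  · intro x hx
    refine mem_of_conn_of_closed (ends := ends) (ω := Function.update ω e true) ?_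
      (Or.inl (mem_cluster_self _ _ _)) hx
    intro a ha b hab
    obtain ⟨_, e', he', hends'⟩ := openGraph_adj.1 hab
    by_cases hee : e' = e
    · subst hee
      rw [hends, Sym2.eq_iff] at hends'
      rcases hends' with ⟨rfl, rfl⟩ | ⟨rfl, rfl⟩
      · exact Or.inr (mem_cluster_self _ _ _)
      · exact Or.inl (mem_cluster_self _ _ _)
    · have he'' : Function.update ω e false e' = true := by
        rw [Function.update_of_ne hee]
        rw [Function.update_of_ne hee] at he'
        exact he'
      rcases ha with ha | ha
      · exact Or.inl (Hull.mem_cluster_of_edge ha he'' hends')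
      · exact Or.inr (Hull.mem_cluster_of_edge ha he'' hends')
  · intro x hx
    rcases hx with hx | hx
    · exact cluster_mono hle s hx
    · exact conn_trans hsw (cluster_mono hle w hx)

omit [Fintype E] in
/-- After opening `e = {s, w}`, `s` avoids `T` iff it avoided `T` before and `w` was not joined to
`T`. -/
lemma update_true_mem_avoidAll_iff (hends : ends e = s(s, w)) (ω : Config E) (T : Finset V) :
    Function.update ω e true ∈ avoidAll ends s T ↔
      Function.update ω e false ∈ avoidAll ends s T ∧
        Function.update ω e false ∉ clusterSetInEvent ends T {S : Set V | w ∈ S} := by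
  simp only [avoidAll, Set.mem_setOf_eq, ← mem_cluster, cluster_update_true_eq hends,
    Set.mem_union, not_or, clusterSetInEvent, mem_clusterSet, not_exists, not_and]
  constructor
  · intro h
    exact ⟨fun t ht => (h t ht).1, fun t ht hc => (h t ht).2 (conn_symm hc)⟩
  · rintro ⟨h1, h2⟩ t ht
    exact ⟨h1 t ht, fun hc => h2 t ht (conn_symm hc)⟩

omit [Fintype E] in
/-- An increasing cluster event at `s` survives the opening of `e`. -/
lemma update_true_mem_clusterInEvent {𝓤 : Set (Set V)} (h𝓤 : IsUpperSet 𝓤) (ω : Config E)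
    (h : Function.update ω e false ∈ clusterInEvent ends s 𝓤) :
    Function.update ω e true ∈ clusterInEvent ends s 𝓤 :=
  h𝓤 (cluster_mono (update_false_le_update_true' ω e) s) h

end Open

/-! ## Probabilities at the pinned weights -/

section Pinned

variable (p : E → R) (e : E)

omit [LinearOrder R] [IsStrictOrderedRing R] in
/-- `P_{p[e↦1]}(A) = P_p(A⁺)`, `A⁺ = {ω ∣ ω[e ↦ open] ∈ A}`. -/
lemma prob_update_one_eq (A : Set (Config E)) :
    prob (Function.update p e 1) A = prob p {ω | Function.update ω e true ∈ A} := by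
  rw [prob_eq_expect_indicator, expect_update_one, prob_eq_expect_indicator]
  congr 1

omit [LinearOrder R] [IsStrictOrderedRing R] in
/-- `P_{p[e↦0]}(A) = P_p(A⁻)`, `A⁻ = {ω ∣ ω[e ↦ closed] ∈ A}`. -/
lemma prob_update_zero_eq (A : Set (Config E)) :
    prob (Function.update p e 0) A = prob p {ω | Function.update ω e false ∈ A} := by
  rw [prob_eq_expect_indicator, expect_update_zero, prob_eq_expect_indicator]
  congr 1

end Pinned

/-! ## The shift lemma -/

section Shift

variable [Fintype V] [DecidableEq V] (p : E → R) (ends : E → Sym2 V) {e : E} {s w : V}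

omit [Fintype E] [DecidableEq E] [Fintype V] [DecidableEq V] [LinearOrder R] [IsStrictOrderedRing R] in
/-- `{T ↮ s}` as a seed-set avoidance is `{s ↮ T}`. -/
lemma avoidAllT_eq_avoidAll (T : Finset V) (s : V) :
    avoidAllT ends T {s} = avoidAll ends s T := by
  ext ω
  simp only [avoidAllT, avoidAll, Set.mem_setOf_eq, Finset.mem_singleton, forall_eq]
  exact ⟨fun h t ht hc => h t ht (conn_symm hc), fun h t ht hc => h t ht (conn_symm hc)⟩

/-- **The shift lemma at a root edge** (mine-c §9.10 (i), cleared): for an up-set `𝓤`,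
`P₀(R ∩ {C(s) ∈ 𝓤}) · P₁(R) ≤ P₁(R ∩ {C(s) ∈ 𝓤}) · P₀(R)`. -/
theorem shift_root_edge (hp : IsProbVec p) (hends : ends e = s(s, w)) (T : Finset V)
    {𝓤 : Set (Set V)} (h𝓤 : IsUpperSet 𝓤) :
    prob (Function.update p e 0) (avoidAll ends s T ∩ clusterInEvent ends s 𝓤) *
        prob (Function.update p e 1) (avoidAll ends s T) ≤
      prob (Function.update p e 1) (avoidAll ends s T ∩ clusterInEvent ends s 𝓤) *
        prob (Function.update p e 0) (avoidAll ends s T) := by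
  have hp₀ : IsProbVec (Function.update p e 0) := hp.update e le_rfl zero_le_one
  set p₀ := Function.update p e 0 with hp₀def
  set p₁ := Function.update p e 1 with hp₁def
  set Rs := avoidAll ends s T with hRs
  set X := clusterInEvent ends s 𝓤 with hX
  set W := clusterSetInEvent ends T {S : Set V | w ∈ S} with hW
  -- (1) `P₁(R) = P₀(R ∩ Wᶜ)`
  have hP : prob p₁ Rs = prob p₀ (Rs ∩ Wᶜ) := by
    rw [hp₁def, hp₀def, prob_update_one_eq, prob_update_zero_eq]
    congr 1
    ext ω
    simp only [Set.mem_setOf_eq, Set.mem_inter_iff, Set.mem_compl_iff, hRs, hW]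
    exact update_true_mem_avoidAll_iff hends ω T
  -- (2) `P₀(R ∩ X ∩ Wᶜ) ≤ P₁(R ∩ X)`
  have hF : prob p₀ (Rs ∩ X ∩ Wᶜ) ≤ prob p₁ (Rs ∩ X) := by
    rw [hp₁def, hp₀def, prob_update_one_eq, prob_update_zero_eq]
    refine prob_mono hp fun ω hω => ?_
    simp only [Set.mem_setOf_eq, Set.mem_inter_iff, Set.mem_compl_iff] at hω ⊢
    exact ⟨(update_true_mem_avoidAll_iff hends ω T).2 ⟨hω.1.1, hω.2⟩,
      update_true_mem_clusterInEvent h𝓤 ω hω.1.2⟩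
  -- (3) BHK 1.3 with the seed set `T` under `p₀`: `P₀(R ∩ X ∩ W) · P₀(R) ≤ P₀(R ∩ X) · P₀(R ∩ W)`
  have hBHK : prob p₀ (Rs ∩ X ∩ W) * prob p₀ Rs ≤ prob p₀ (Rs ∩ X) * prob p₀ (Rs ∩ W) := by
    have key := bhk_cross_clusterT p₀ hp₀ ends T s (𝓤 := {S : Set V | w ∈ S}) (𝓥 := 𝓤)
      (fun _ _ hST h => hST h) h𝓤
    rw [avoidAllT_eq_avoidAll] at key
    have e1 : W ∩ X ∩ Rs = Rs ∩ X ∩ W := by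
      ext ω; simp only [Set.mem_inter_iff]; tauto
    have e2 : W ∩ Rs = Rs ∩ W := Set.inter_comm _ _
    have e3 : X ∩ Rs = Rs ∩ X := Set.inter_comm _ _
    rw [e1, e2, e3] at key
    linarith
  -- (4) complements
  have h4 := prob_inter_add_prob_inter_compl p₀ (Rs ∩ X) W
  have h5 := prob_inter_add_prob_inter_compl p₀ Rs W
  have hP0 := prob_nonneg hp₀ Rs
  have hF' := mul_le_mul_of_nonneg_right hF hP0
  have e4 : prob p₀ (Rs ∩ X ∩ W) * prob p₀ Rs + prob p₀ (Rs ∩ X ∩ Wᶜ) * prob p₀ Rs =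
      prob p₀ (Rs ∩ X) * prob p₀ Rs := by rw [← h4]; ring
  have e5 : prob p₀ (Rs ∩ X) * prob p₀ (Rs ∩ W) + prob p₀ (Rs ∩ X) * prob p₀ (Rs ∩ Wᶜ) =
      prob p₀ (Rs ∩ X) * prob p₀ Rs := by rw [← h5]; ring
  -- `F₁ P₀ ≥ (F₀ − Π_X) P₀ ≥ F₀ P₀ − F₀ Π = F₀ P₁`
  rw [hP]
  linarith

end Shift

/-! ## (CC-T) at a root edge -/

section Main

variable [Fintype V] [DecidableEq V] (p : E → R) (ends : E → Sym2 V) {e : E} {s w : V}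

omit [Fintype E] [DecidableEq E] [Fintype V] [DecidableEq V] [LinearOrder R] [IsStrictOrderedRing R] in
/-- `{A ⊆ C(s)}` is the cluster event of the up-set `{S ∣ A ⊆ S}`. -/
lemma connAll_eq_clusterInEvent (A : Finset V) :
    connAll ends s A = clusterInEvent ends s {S : Set V | ↑A ⊆ S} := by
  ext ω
  simp only [connAll, Set.mem_setOf_eq, clusterInEvent, Set.subset_def, Finset.mem_coe,
    mem_cluster]

omit [Fintype E] [DecidableEq E] [Fintype V] [LinearOrder R] [IsStrictOrderedRing R] in
/-- `{A ∪ B ⊆ C(s)} = {A ⊆ C(s)} ∩ {B ⊆ C(s)}`. -/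
lemma connAll_union (A B : Finset V) :
    connAll ends s (A ∪ B) = connAll ends s A ∩ connAll ends s B := by
  ext ω
  simp only [connAll, Set.mem_setOf_eq, Set.mem_inter_iff, Finset.mem_union, or_imp, forall_and]

/-- **The algebra of (CC-T)**: `vdBK` on the contracted instance plus two shifts of the same
sign give `CC2 p ends e s A B T T` (the identity
`P₁ · slack = P₀² (H₁P₁ − F₁G₁) + (F₁P₀ − F₀P₁)(G₁P₀ − G₀P₁)`; `P₁ = 0` is the degenerate case). -/
theorem ccT_of_shift_product (hp : IsProbVec p) (e : E) (s : V) (A B T : Finset V)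
    (hprod : 0 ≤ (prob (Function.update p e 1) (avoidAll ends s T ∩ connAll ends s A) *
        prob (Function.update p e 0) (avoidAll ends s T) -
      prob (Function.update p e 0) (avoidAll ends s T ∩ connAll ends s A) *
        prob (Function.update p e 1) (avoidAll ends s T)) *
      (prob (Function.update p e 1) (avoidAll ends s T ∩ connAll ends s B) *
        prob (Function.update p e 0) (avoidAll ends s T) -
      prob (Function.update p e 0) (avoidAll ends s T ∩ connAll ends s B) *
        prob (Function.update p e 1) (avoidAll ends s T))) :
    TwoSetRung.CC2 p ends e s A B T T := by
  unfold TwoSetRung.CC2 TwoSetRung.massP TwoSetRung.massF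
  rw [Finset.union_self, Finset.inter_self]
  have hp₀ : IsProbVec (Function.update p e 0) := hp.update e le_rfl zero_le_one
  have hp₁ : IsProbVec (Function.update p e 1) := hp.update e zero_le_one le_rfl
  set p₀ := Function.update p e 0 with hp₀def
  set p₁ := Function.update p e 1 with hp₁def
  set Rs := avoidAll ends s T with hRs
  -- vdB–Kahn on the contracted instance: `F₁ G₁ ≤ H₁ P₁`
  have hbhk := vdBK p₁ hp₁ ends s A B T T
  rw [Finset.inter_self, Finset.union_self, Set.inter_comm (connAll ends s A),
    Set.inter_comm (connAll ends s B), Set.inter_comm (connAll ends s (A ∪ B))] at hbhk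
  set P₁ := prob p₁ Rs with hP₁
  set P₀ := prob p₀ Rs with hP₀
  set F₁ := prob p₁ (Rs ∩ connAll ends s A)
  set F₀ := prob p₀ (Rs ∩ connAll ends s A)
  set G₁ := prob p₁ (Rs ∩ connAll ends s B)
  set G₀ := prob p₀ (Rs ∩ connAll ends s B)
  set H₁ := prob p₁ (Rs ∩ connAll ends s (A ∪ B))
  have hF₁ : F₁ ≤ P₁ := prob_mono hp₁ Set.inter_subset_left
  have hG₁ : G₁ ≤ P₁ := prob_mono hp₁ Set.inter_subset_left
  have hH₁ : H₁ ≤ P₁ := prob_mono hp₁ Set.inter_subset_left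
  have hF₁0 : 0 ≤ F₁ := prob_nonneg hp₁ _
  have hG₁0 : 0 ≤ G₁ := prob_nonneg hp₁ _
  have hH₁0 : 0 ≤ H₁ := prob_nonneg hp₁ _
  have hP₁0 : 0 ≤ P₁ := prob_nonneg hp₁ _
  rcases hP₁0.lt_or_eq with hpos | hzero
  · have hslack : 0 ≤ P₁ * (H₁ * P₀ ^ 2 + F₀ * G₀ * P₁ - P₀ * (F₁ * G₀ + F₀ * G₁)) := by
      have h1 : 0 ≤ P₀ ^ 2 * (H₁ * P₁ - F₁ * G₁) :=
        mul_nonneg (sq_nonneg _) (by linarith)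
      nlinarith [h1, hprod]
    have := (mul_nonneg_iff_of_pos_left hpos).1 hslack
    linarith
  · have hF₁z : F₁ = 0 := le_antisymm (hzero ▸ hF₁) hF₁0
    have hG₁z : G₁ = 0 := le_antisymm (hzero ▸ hG₁) hG₁0
    have hH₁z : H₁ = 0 := le_antisymm (hzero ▸ hH₁) hH₁0
    rw [hF₁z, hG₁z, hH₁z, ← hzero]
    ring_nf
    exact le_refl _

/-- **(CC-T) at every edge incident to the root** (mine-c §9.10 (i)): for an edge `e = {s, w}`,
`CC2 p ends e s A B T T` holds for every admissible `p`, every avoided set `T` and targets `A, B`. -/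
theorem ccT_root_edge (hp : IsProbVec p) (hends : ends e = s(s, w)) (A B T : Finset V) :
    TwoSetRung.CC2 p ends e s A B T T := by
  refine ccT_of_shift_product p ends hp e s A B T ?_
  have hA := shift_root_edge p ends hp hends T (𝓤 := {S : Set V | ↑A ⊆ S})
    (fun _ _ hST h => h.trans hST)
  have hB := shift_root_edge p ends hp hends T (𝓤 := {S : Set V | ↑B ⊆ S})
    (fun _ _ hST h => h.trans hST)
  rw [← connAll_eq_clusterInEvent] at hA hB
  exact mul_nonneg (by linarith) (by linarith)

end Main

end CCT

end Summit.Ventures.PercRepro2
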